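import Summits.AtomisticToContinuum.BoseEinsteinCondensation.Theses.BECJastrowEulerLagrange
import Summits.AtomisticToContinuum.BoseEinsteinCondensation.Theses.BECPeriodicReduction
import Summits.AtomisticToContinuum.BoseEinsteinCondensation.Theses.BECRieszShadow
import Summits.AtomisticToContinuum.BoseEinsteinCondensation.Theses.BECRiccatiGhostPlasma

/-!
# cstrat r1 — typed decomposition attempts for `JastrowShadowTransfer` (stmt-AtomisticToContinuum-13403)

Companion to `STRATEGY-CENSUS.md §Decomposition`.  Every candidate split of the crux
`JastrowShadowTransfer := JastrowTailRigidity → OptimalJastrowBEC → ⟨PeriodicBEC body⟩`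
is typed here and its assembly kernel-checked, so the census can say *which* of the redirect
conditions (a) k ≥ 2 load-bearing pieces · (b) assembly proved · (c) no piece gives S or the crux
alone · (d) every open piece planned — fails, and WHY the failure is structural:

* **Split R (affinity attach).**  Pieces = `BECRieszShadow.PalmAffinityBound` (stmt-9157) and
  `BECRiccatiGhostPlasma.AffinityToPeriodicBEC` (stmt-14694), both EXISTING items (dedup would attach
  this route).  Assembly `splitR_of` is two applications — and it DISCARDS both Jastrow antecedents:
  `splitR_periodicBEC` shows the same two pieces already give `PeriodicBEC` (stmt-0826) itself, i.e.
  Split R is route BECRieszShadow/BECRiccatiGhostPlasma's decomposition of `PeriodicBEC`, not a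
  decomposition of this crux.  (a) ✓ (b) ✓ (c) ✓ formally; fails as a REDIRECT: duplicate of a listed
  route's load-bearing cone, antecedents smuggled (the judge's flag), no new plan.
* **Split J (dressing over the optimal Jastrow factor).**  The only cut in which the route's OWN
  antecedent `OptimalJastrowBEC` is consumed: J1 `OptimalDressingPalmBound` (one-sided Palm mean of the
  teleport work of the DRESSING `W = −log Ψ₀ + log J_φ` over a near-optimal pair profile φ, bounded
  uniformly in N and separation — bounded-v class), J2 `DressedCondensateTransfer` (J1 ∧ BEC of the
  optimal Jastrow state ⇒ BEC of near-minimisers, bounded class), J3 `HardCoreShadow` (the hard-core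
  class, which no Jastrow/KL currency reaches).  Assembly `splitJ_of` proved (excluded middle on
  boundedness).  Census verdict: J1 ⟺ `BeyondPairGhostWork` (stmt-13505) up to an O(1) pair-part
  correction that does not see optimality (pair-part inertness, census §Decomposition); J2 has no
  first lemma (change of Palm measure P^φ_x ↔ P_x is an orthogonality catastrophe; the Jensen chain
  that works never uses `OptimalJastrowBEC`); J3 is `PeriodicBEC` on hard spheres = the named open
  problem.  Fails (d) for J2/J3 and (c)-in-substance for J3.

Nothing here is filed as an item; the defs are census artefacts (strategist seat, no registry writes
beyond `crux write`).
-/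

namespace Summit.AtomisticToContinuum.BoseEinsteinCondensation.Cruxes.JastrowShadowTransfer.Census

open Summit.AtomisticToContinuum.BoseEinsteinCondensation.Theses
open Literature.MathematicalPhysics.QuantumManyBody.BoseGas

/-! ## Split R — affinity attach (existing items 9157 + 14694) -/

/-- Split R assembly: `PalmAffinityBound (9157) → AffinityToPeriodicBEC (14694) → JastrowShadowTransfer`.
The proof term ignores both Jastrow antecedents (`fun hA hAP _ _ => …`). -/
theorem splitR_of :
    BECRieszShadow.PalmAffinityBound → BECRiccatiGhostPlasma.AffinityToPeriodicBEC →
      BECJastrowEulerLagrange.JastrowShadowTransfer :=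
  fun hA hAP _ _ v hv => hAP v hv (hA v hv)

/-- … because the same two pieces already assemble `PeriodicBEC` (stmt-0826) — Split R is the
RieszShadow/Riccati decomposition of the periodic summit form, verbatim. -/
theorem splitR_periodicBEC :
    BECRieszShadow.PalmAffinityBound → BECRiccatiGhostPlasma.AffinityToPeriodicBEC →
      BECPeriodicReduction.PeriodicBEC :=
  fun hA hAP v hv => hAP v hv (hA v hv)

/-- and Split R factors through it. -/
theorem splitR_factors (hA : BECRieszShadow.PalmAffinityBound)
    (hAP : BECRiccatiGhostPlasma.AffinityToPeriodicBEC) :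
    splitR_of hA hAP = fun _ _ => splitR_periodicBEC hA hAP := rfl

/-! ## Split J — dressing over the (near-)optimal Jastrow factor -/

/-- The conclusion of the crux restricted to a class of potentials `P`. -/
def ShadowOn (P : (ℝ → ENNReal) → Prop) : Prop :=
  ∀ v : ℝ → ENNReal, IsRepulsiveFiniteRange v → P v →
    ∃ ρ₀ : ℝ, 0 < ρ₀ ∧ ∀ ρ : ℝ, 0 < ρ → ρ < ρ₀ → ∃ c : ℝ, 0 < c ∧ ∀ᶠ N : ℕ in Filter.atTop,
      ∃ δ : ENNReal, 0 < δ ∧ ∀ Ψ : PeriodicTrialState N (sideLength ρ N),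
        periodicEnergy v Ψ ≤ periodicGroundStateEnergy v N (sideLength ρ N) + δ →
          ENNReal.ofReal (c * N) ≤ condensateOccupation N (sideLength ρ N) Ψ.ψ

/-- Bounded (soft) potentials. -/
def IsBounded (v : ℝ → ENNReal) : Prop := ∃ M : NNReal, ∀ r, v r ≤ M

/-- **J1 · OptimalDressingPalmBound.**  For every bounded admissible `v`, small `ρ`, eventually in
`N = m + 2`: for every exact positive translation-invariant periodic ground state `Ψ` and every
everywhere-positive pair profile `φ` whose Jastrow trial state is `η`-optimal within the Jastrow
manifold (η chosen after N, like the crux's δ), the one-sided Palm mean (law of the bath given a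
particle at `x`) of the teleport work of the DRESSING `W = −log Ψ + log J_φ`,
`W(y,Y) − W(x,Y) = [log Ψ(x,Y) − log Ψ(y,Y)] − [log J_φ(x,Y) − log J_φ(y,Y)]`,
is `≤ C` uniformly in `x, y, N`.  Shape copied from `BeyondPairGhostWork` (13505) with the Hoeffding
pair projection replaced by the optimal Jastrow pair factor. -/
def OptimalDressingPalmBound : Prop :=
  ∀ v : ℝ → ENNReal, IsRepulsiveFiniteRange v → IsBounded v →
    ∃ ρ₀ : ℝ, 0 < ρ₀ ∧ ∀ ρ : ℝ, 0 < ρ → ρ < ρ₀ → ∃ C : ℝ, ∀ᶠ m : ℕ in Filter.atTop, ∃ η : ENNReal, 0 < η ∧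
      ∀ Ψ : PeriodicTrialState (m + 2) (sideLength ρ (m + 2)),
        periodicEnergy v Ψ = periodicGroundStateEnergy v (m + 2) (sideLength ρ (m + 2)) →
        (∀ X, 0 < (Ψ.ψ X).re ∧ (Ψ.ψ X).im = 0) →
        (∀ (a : Space) (X : Config (m + 2)), Ψ.ψ (fun i => X i + a) = Ψ.ψ X) →
        ∀ (hL : 0 < sideLength ρ (m + 2)) (b : ℝ) (φ : Space → ℝ) (hφ : IsPairProfile b φ)
          (hbL : 2 * b < sideLength ρ (m + 2))
          (hν : 0 < jastrowNormR (sideLength ρ (m + 2)) φ (Finset.univ : Finset (Fin (m + 2)))),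
          (∀ z, 0 < φ z) →
          periodicEnergy v (hφ.trialState hL hbL hν) ≤
            (⨅ (hL' : 0 < sideLength ρ (m + 2)) (b' : ℝ) (φ' : Space → ℝ) (hφ' : IsPairProfile b' φ')
              (hbL' : 2 * b' < sideLength ρ (m + 2))
              (hν' : 0 < jastrowNormR (sideLength ρ (m + 2)) φ' (Finset.univ : Finset (Fin (m + 2)))),
              periodicEnergy v (hφ'.trialState hL' hbL' hν')) + η →
          ∀ x y : Space,
            (∫ Y in cellN (m + 1) (sideLength ρ (m + 2)),
                (Ψ.ψ (Matrix.vecCons x Y)).re ^ 2 *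
                  ((Real.log ((Ψ.ψ (Matrix.vecCons x Y)).re) - Real.log ((Ψ.ψ (Matrix.vecCons y Y)).re)) -
                    (Real.log (jastrow (sideLength ρ (m + 2)) φ Finset.univ (Matrix.vecCons x Y)) -
                      Real.log (jastrow (sideLength ρ (m + 2)) φ Finset.univ (Matrix.vecCons y Y))))) ≤
              C * ∫ Y in cellN (m + 1) (sideLength ρ (m + 2)), (Ψ.ψ (Matrix.vecCons x Y)).re ^ 2

/-- **J2 · DressedCondensateTransfer.**  Bounded dressing cost over the optimal Jastrow factor AND
condensation of the optimal Jastrow state (the route's `OptimalJastrowBEC`, stmt-13401) ⇒ condensation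
of periodic near-minimisers, bounded class.  This is the piece that would make the route's antecedent
load-bearing; the census records why it has no first lemma. -/
def DressedCondensateTransfer : Prop :=
  OptimalDressingPalmBound → BECJastrowEulerLagrange.OptimalJastrowBEC → ShadowOn IsBounded

/-- **J3 · HardCoreShadow.**  The hard-core class (`v` unbounded, e.g. `v = ⊤` on `[0,a]`): periodic BEC
for near-minimisers — the named open problem for hard spheres (LSSY Ch. 5); no Jastrow/KL currency
reaches it (KL(Ψ₀² ‖ J_φ²) = ∞ unless the nodal sets agree). -/
def HardCoreShadow : Prop := ShadowOn fun v => ¬ IsBounded v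

/-- Split J assembly (excluded middle on boundedness); uses `hB`, discards `hT`
(`JastrowTailRigidity` is consumed by no piece: the tail shape of φ* enters no transfer currency). -/
theorem splitJ_of :
    OptimalDressingPalmBound → DressedCondensateTransfer → HardCoreShadow →
      BECJastrowEulerLagrange.JastrowShadowTransfer :=
  fun h1 h2 h3 _hT hB v hv =>
    (Classical.em (IsBounded v)).elim (fun hb => h2 h1 hB v hv hb) (fun hb => h3 v hv hb)

/-- The two class pieces alone already give `PeriodicBEC` once J1 ∧ OJB are fed in — i.e. modulo J1
the split is again a split of the periodic summit form by potential class. -/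
theorem splitJ_periodicBEC (h1 : OptimalDressingPalmBound)
    (hB : BECJastrowEulerLagrange.OptimalJastrowBEC) (h2 : DressedCondensateTransfer)
    (h3 : HardCoreShadow) : BECPeriodicReduction.PeriodicBEC :=
  fun v hv => (Classical.em (IsBounded v)).elim (fun hb => h2 h1 hB v hv hb) (fun hb => h3 v hv hb)

end Summit.AtomisticToContinuum.BoseEinsteinCondensation.Cruxes.JastrowShadowTransfer.Census
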